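import Summits.QuantumFields.YangMills.Theorems.IR.SCFloorFacingPlaquette
import Literature.LinearAlgebra.Matrix.TraceSingularValueInequality

/-!
# Strong-coupling floor engine, part 12: the `β⁴` law in the binders of the `IR` lines

Pooled prover `ym-ir-line-bsf-p1` (crux `IR`, stmt-QuantumFields-19354).  The engine
`SCFloor.facingPlaquetteCorr_floor` (part 11) restated for a `LatticeRep r` of a compact simple Lie group `G` with
the Borel σ-algebra, i.e. in exactly the binder shape of the line files
(`∀ G …, IsCompactSimpleLieGroup G → letI := borel G; haveI : BorelSpace G := ⟨rfl⟩; ∀ r : LatticeRep G, …`):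
the side conditions of part 11 are discharged here — `G` is Hausdorff and second countable because the faithful
representation `r.ρ` is a closed embedding into a matrix space, and `Re tr r.ρ` is non-constant because `G` is
non-abelian (so has some `g ≠ 1`) and `Re tr U = N` forces a unitary `U` to be `1` (Horn–Johnson 7.4.1.4).
Consumers: line `momentum-pincer` rung R2 (`NoLightMoversSCTransfer`), line `ym_ir7_volume_monotone_gap`
(`TraceExcessFloorSC`).  HONEST: strong coupling only; nothing here bears on `BalabanLadder.IR` at weak coupling or
on the Clay Yang–Mills mass gap.
-/

set_option autoImplicit false

noncomputable section

open MeasureTheory Filter Topology Function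
open Literature.MathematicalPhysics.QuantumFieldTheory
open Literature.MathematicalPhysics.QuantumLattice (plaquetteObs IsSimpleCompactGroup)

namespace Summit.QuantumFields.YangMills.Cruxes.IR.SCFloor

/-- For a faithful unitary representation `r` of a non-abelian group, `Re tr r.ρ` is not constant: some `g ≠ 1`
exists, `r.ρ g ≠ 1 = r.ρ 1` by faithfulness, and a unitary `U ≠ 1` has `Re tr U ≠ N = Re tr 1`. -/
theorem latticeRep_re_trace_nonconst {G : Type} [Group G] [TopologicalSpace G] (hG : ∃ a b : G, a * b ≠ b * a)
    (r : LatticeRep G) : ∃ g h : G, (r.ρ g).trace.re ≠ (r.ρ h).trace.re := by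
  obtain ⟨a, b, hab⟩ := hG
  have ha : a ≠ 1 := by
    rintro rfl
    exact hab (by rw [one_mul, mul_one])
  refine ⟨a, 1, fun h => ha (r.injective ?_)⟩
  rw [map_one]
  have hN : ((r.ρ 1).trace).re = (Fintype.card (Fin r.N) : ℝ) := by
    rw [map_one, Matrix.trace_one, Fintype.card_fin]
    simp
  rw [hN] at h
  have h' : RCLike.re (Matrix.trace (r.ρ a)) = Fintype.card (Fin r.N) := by
    simpa using h
  exact (Literature.LinearAlgebra.Matrix.re_trace_eq_card_iff_of_mem_unitaryGroup (r.mem_unitary a)).1 h'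

/-- **The engine in the binders of the `IR` lines.**  For every compact simple Lie group `G` (Borel σ-algebra) and
every `r : LatticeRep G` there are `β₀, c, C > 0` with, on every torus `(ℤ/L)⁴`, `L ≥ 3`, and for all
`0 < β ≤ β₀`: `c β⁴ ≤ latticeConnectedCorr r.ρ β L P P 1 ≤ C β⁴`, `P = plaquetteObs r.ρ 0 1 2`
(volume-uniform two-sided strong-coupling `β⁴` law for the facing-plaquette connected correlator). -/
theorem facingPlaquetteCorr_floor_latticeRep :
    ∀ (G : Type) [Group G] [TopologicalSpace G] [IsTopologicalGroup G] [CompactSpace G],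
      IsCompactSimpleLieGroup G →
      letI := borel G; haveI : BorelSpace G := ⟨rfl⟩;
      ∀ (r : LatticeRep G), ∃ β₀ c C : ℝ, 0 < β₀ ∧ 0 < c ∧ c ≤ C ∧
        ∀ (L : ℕ) [NeZero L], 3 ≤ L → ∀ β : ℝ, 0 < β → β ≤ β₀ →
          c * β ^ 4 ≤ latticeConnectedCorr r.ρ β L (plaquetteObs r.ρ 0 1 2) (plaquetteObs r.ρ 0 1 2) 1 ∧
            latticeConnectedCorr r.ρ β L (plaquetteObs r.ρ 0 1 2) (plaquetteObs r.ρ 0 1 2) 1 ≤ C * β ^ 4 := by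
  intro G _ _ _ _ hG
  letI : MeasurableSpace G := borel G
  haveI : BorelSpace G := ⟨rfl⟩
  intro r
  have hemb : IsClosedEmbedding r.ρ := r.continuous.isClosedEmbedding r.injective
  haveI : T2Space G := hemb.isEmbedding.t2Space
  haveI : SecondCountableTopology G := hemb.isEmbedding.secondCountableTopology
  exact facingPlaquetteCorr_floor r.ρ r.continuous (latticeRep_re_trace_nonconst hG.1.2.1 r)

end Summit.QuantumFields.YangMills.Cruxes.IR.SCFloor

end
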